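import Summits.ResolutionOfSingularities.ResolutionOfSingularities.Theorems.FrobeniusLadderFInjectiveMacaulayficationCNConeFiModelRel
import HarnessLib

/-!
# (G4ᴾ-rel, OPEN-RESTRICTED) the CN chart clause over `D(h)`: face certificates asked only over the open (ticket M2, R12.16)
# (crux `FInjectiveMacaulayfication` stmt-ResolutionOfSingularities-15315, chain w45a; owner res-L1-w45a-lead-1 gen 4)

[OURS · L1 W4.5a] Support file (`--supports stmt-ResolutionOfSingularities-15315 --as helper`) for the crux
`FrobeniusLadder.FInjectiveMacaulayfication`; NOT a statement of any manuscript; AI-written, weaker than expert review.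

Ruling R12.16/R12.16a of res-L1-w45a-plan-1 (HOME/STATUS 09:07Z/09:10Z) on the M2 pair: the Cartier–Newton face data of the
open-restricted relative CN engine must themselves be restricted to the open `D(h)`, or the engine is vacuous for its consumer
(f_cusp/𝔽₃ move 2, Γ₂-steps: the J-lowest component carries the factor `(1 + a)³`, whose torus zero is the bad curve `C̃′`). This
file provides the chart-level pieces:
* `toricChart_fedder_at` — C2 `ToricChartFedderAssembly.toricChart_fedder` with the face hypothesis asked only at the one torus point
  `θ(ã)` used by the proof (`ã` = the chart point with its vanishing coordinates set to `1`); proof copied verbatim;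
* `cnChartClauseRelOpen` — G4ᴾ-rel `CNConeFiModelRel.cnChartClauseRel` at the maximal ideals over the stratum NOT containing `θ(h)`,
  from face certificates asked only at chart points `a` with `(θ h)(a) ≠ 0` («the chart point lies over `D(h)`», which is what the
  proof has: `θ h ∉ P`).
The global assembly over `D(h̄)` with these binders is `CNConeFiModelRelOpenH` (next file). No definitions, no named facts. [folklore]
-/

-- single-problem summit: the doubled namespace component is forced
set_option linter.dupNamespace false

noncomputable section

open AlgebraicGeometry CategoryTheory Literature.AlgebraicGeometry.Resolution MvPolynomial

namespace Summit.ResolutionOfSingularities.ResolutionOfSingularities.Theorems.FInjectiveMacaulayfication.CNChartClauseRelOpen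

open Summit.ResolutionOfSingularities.ResolutionOfSingularities.Theorems.FInjectiveMacaulayfication
open Literature.RingTheory.TightClosure
open ToricChartFedderAssembly

variable {n : ℕ}

/-- **Fedder at a chart point from ONE face certificate** — `ToricChartFedderAssembly.toricChart_fedder` (p492570-series, C2) with
the Cartier–Newton face hypothesis asked ONLY at the single torus point the proof uses: `b = θ(ã)`, where `ã` is the chart point
`a` with its vanishing coordinates (`S`) replaced by `1`. Same proof, verbatim. [folklore] -/
theorem toricChart_fedder_at (p : ℕ) [hp : Fact p.Prime] {k : Type} [Field k] [CharP k p]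
    (f : MvPolynomial (Fin n) k) (V : Matrix (Fin n) (Fin n) ℕ)
    (hV : IsUnit (V.map (Nat.cast : ℕ → ℤ)).det)
    (d : Fin n →₀ ℕ) (g : MvPolynomial (Fin n) k)
    (hg : aeval (fun j : Fin n => ∏ i : Fin n, (X i : MvPolynomial (Fin n) k) ^ V i j) f = monomial d (1 : k) * g)
    (K : Type) [Field K] [CharP K p] [Algebra k K] (a : Fin n → K)
    (S : Finset (Fin n)) (hS : ∀ i, i ∈ S ↔ a i = 0) (hSne : S.Nonempty)
    (hf : ∀ D : ℕ, (weightedHomogeneousComponent (fun j : Fin n => ∑ i ∈ S, V i j) D f ≠ 0 ∧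
        ∀ D' < D, weightedHomogeneousComponent (fun j : Fin n => ∑ i ∈ S, V i j) D' f = 0) →
        aeval (fun j : Fin n => ∏ i : Fin n, (if i ∈ S then (1 : K) else a i) ^ V i j)
          (weightedHomogeneousComponent (fun j : Fin n => ∑ i ∈ S, V i j) D f) = 0 →
          (map (algebraMap k K) (weightedHomogeneousComponent (fun j : Fin n => ∑ i ∈ S, V i j) D f)) ^ (p - 1) ∉
            Ideal.span (Set.range fun i : Fin n => (X i - C (∏ i' : Fin n, (if i' ∈ S then (1 : K) else a i') ^ V i' i)) ^ p))
    (hface : ∃ m ∈ f.support, ∀ i ∈ S, ∑ j : Fin n, V i j * m j = d i)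
    (ha : aeval a g = 0) :
    (map (algebraMap k K) g) ^ (p - 1) ∉ Ideal.span (Set.range fun i : Fin n => (X i - C (a i)) ^ p) := by
  classical
  have _ := hSne
  have hp0 : p ≠ 0 := hp.out.ne_zero
  -- notation
  set w : Fin n → ℕ := fun j => ∑ i ∈ S, V i j with hw
  set D : ℕ := ∑ i ∈ S, d i with hD
  set P₀ : MvPolynomial (Fin n) k := weightedHomogeneousComponent w D f with hP₀
  set G : MvPolynomial (Fin n) K := map (algebraMap k K) g with hG
  set gS : MvPolynomial (Fin n) K :=
    aeval (fun i : Fin n => if i ∈ S then (0 : MvPolynomial (Fin n) K) else X i) G with hgS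
  -- (B4) the initial degree and the chart identity, base-changed to `K`
  have hID := ToricChartFedder.isInitialDegree_face V hV f g d hg S hface
  have hident : monomial d (1 : K) * gS =
      aeval (fun j : Fin n => ∏ i : Fin n, (X i : MvPolynomial (Fin n) K) ^ V i j) (map (algebraMap k K) P₀) := by
    have h := congrArg (map (algebraMap k K)) (ToricChartFedder.monomial_mul_substZero_eq_theta_component V hV f g d hg S)
    rw [map_mul, map_monomial, map_one, map_substZero, map_theta] at h
    exact h
  -- the torus point `ã` and its image `b`
  set at' : Fin n → K := fun i => if i ∈ S then (1 : K) else a i with hat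
  have hat0 : ∀ i, at' i ≠ 0 := fun i => by
    by_cases hi : i ∈ S
    · rw [hat]; simp only [hi, if_true]; exact one_ne_zero
    · rw [hat]; simp only [hi, if_false]; exact fun h => hi ((hS i).mpr h)
  have hb0 : ∀ j, (∏ i : Fin n, at' i ^ V i j) ≠ 0 := fun j =>
    Finset.prod_ne_zero_iff.mpr fun i _ => pow_ne_zero _ (hat0 i)
  -- `g(Y_S = 0)` evaluated at `ã` is `g(a) = 0`
  have hsub : (fun i : Fin n => if i ∈ S then (0 : K) else at' i) = a := by
    funext i
    by_cases hi : i ∈ S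
    · rw [if_pos hi, ((hS i).mp hi)]
    · rw [if_neg hi, hat]; simp only [hi, if_false]
  have hgS_at : aeval at' gS = 0 := by
    rw [hgS, aeval_substZero, hsub, hG, aeval_map_algebraMap, ha]
  -- the face polynomial vanishes at `b`
  have hvan : aeval (fun j : Fin n => ∏ i : Fin n, at' i ^ V i j) P₀ = 0 := by
    have h1 : aeval (fun j : Fin n => ∏ i : Fin n, at' i ^ V i j) (map (algebraMap k K) P₀) = 0 := by
      rw [← aeval_theta V at', ← hident, map_mul, hgS_at, mul_zero]
    rwa [aeval_map_algebraMap] at h1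
  -- face F-purity at the torus point `b`
  have hfed_b : (map (algebraMap k K) P₀) ^ (p - 1) ∉
      Ideal.span (Set.range fun i : Fin n => (X i - C (∏ i' : Fin n, at' i' ^ V i' i)) ^ p) := hf D hID hvan
  -- (B3) transport to `ã`
  have hfed_at := MonomialChartFrobeniusTransport.fedder_monomialChart_of_fedder p V hV at' hat0
    (map (algebraMap k K) P₀) hfed_b
  rw [← hident] at hfed_at
  -- (B2) remove the monomial factor `Y^d` (non-zero at `ã`)
  haveI := isMaximal_span_X_sub_C at'
  have hmon : (monomial d (1 : K) : MvPolynomial (Fin n) K) ∉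
      Ideal.span (Set.range fun i : Fin n => X i - C (at' i)) := by
    intro hmem
    have hz : aeval at' (monomial d (1 : K) : MvPolynomial (Fin n) K) = 0 := by
      have hle : Ideal.span (Set.range fun i : Fin n => X i - C (at' i)) ≤
          RingHom.ker (aeval at' : MvPolynomial (Fin n) K →ₐ[K] K).toRingHom := by
        rw [Ideal.span_le]
        rintro _ ⟨i, rfl⟩
        rw [SetLike.mem_coe, RingHom.mem_ker]
        change aeval at' (X i - C (at' i)) = 0
        rw [map_sub, aeval_X, aeval_C, Algebra.algebraMap_self, RingHom.id_apply, sub_self]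
      exact hle hmem
    rw [aeval_monomial, Algebra.algebraMap_self, RingHom.id_apply, one_mul,
      Finsupp.prod_fintype _ _ (fun i => by simp)] at hz
    exact Finset.prod_ne_zero_iff.mpr (fun i _ => pow_ne_zero _ (hat0 i)) hz
  have hfed_gS_at : gS ^ (p - 1) ∉ Ideal.span (Set.range fun i : Fin n => (X i - C (at' i)) ^ p) := fun hmem =>
    hfed_at ((FedderPointReductions.mul_pow_mem_frobeniusSpan_iff p hp0 at' _ rfl (monomial d (1 : K)) gS hmon
      (p - 1)).mpr hmem)
  -- (B1) from `ã` to `a` (the `S`-coordinates are irrelevant for the `S`-free polynomial `g(Y_S = 0)`), then lift to `g`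
  have hφa : (fun i : Fin n => if i ∈ S then C (a i) else (X i : MvPolynomial (Fin n) K)) =
      fun i : Fin n => if i ∈ S then (0 : MvPolynomial (Fin n) K) else X i := by
    funext i
    by_cases hi : i ∈ S
    · rw [if_pos hi, if_pos hi, (hS i).mp hi, map_zero]
    · rw [if_neg hi, if_neg hi]
  have hfix : aeval (fun i : Fin n => if i ∈ S then C (a i) else (X i : MvPolynomial (Fin n) K)) gS = gS := by
    rw [hφa, hgS, ← AlgHom.comp_apply, comp_aeval]
    have h : (fun i : Fin n => aeval (fun i : Fin n => if i ∈ S then (0 : MvPolynomial (Fin n) K) else X i)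
        (if i ∈ S then (0 : MvPolynomial (Fin n) K) else X i)) =
        fun i : Fin n => if i ∈ S then (0 : MvPolynomial (Fin n) K) else X i := by
      funext i
      by_cases hi : i ∈ S
      · simp only [hi, if_true, map_zero]
      · simp only [hi, if_false, aeval_X]
    rw [h]
  have hfed_gS_a : gS ^ (p - 1) ∉ Ideal.span (Set.range fun i : Fin n => (X i - C (a i)) ^ p) := fun hmem =>
    hfed_gS_at (FedderPointReductions.pow_mem_frobeniusSpan_of_subst p hp0 S a a at' (fun _ _ => rfl)
      (fun i hi => by rw [hat]; simp only [hi, if_false]) gS (p - 1) hfix hmem)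
  refine FedderPointReductions.faceFedder_lift_finset p hp0 S a G (p - 1) ?_
  rw [hφa, ← hgS]
  exact hfed_gS_a

/-- **(G4ᴾ-rel, OPEN-RESTRICTED) THE CN CHART CLAUSE OVER THE STRATUM AND OVER `D(h)`.** As
`CNConeFiModelRel.cnChartClauseRel` (res-D-pv-017 AS res-L1-w45a-stub-5, p497132) — one vertex chart `θ : Xⱼ ↦ ∏ᵢ yᵢ^(V i j)`,
`θ f = y^d · g`, `(g)` prime — with TWO changes: the chart clause is concluded only at the maximal ideals `Q` (containing every
`θ(Xⱼ)`, `j ∈ J`) that do NOT contain `θ(h)`, and accordingly the Cartier–Newton face hypothesis is asked only at chart points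
`a` (vanishing set `S`) LYING OVER `D(h)` — premise `(θ h)(a) ≠ 0` — and only at the torus point `θ(ã)` the proof uses
(`toricChart_fedder_at`). The f_cusp/𝔽₃ move-2 consumer (Γ₂-steps, stub-2) needs exactly this: its face certificates fail at the
points over `Q′ ∈ V(h)`. [folklore] -/
theorem cnChartClauseRelOpen : ∀ (p : ℕ) [Fact p.Prime] (k : Type) [Field k] [CharP k p] (n : ℕ) (J : Finset (Fin n)), J.Nonempty →
    ∀ (f : MvPolynomial (Fin n) k) (V : Matrix (Fin n) (Fin n) ℕ), IsUnit (V.map (Nat.cast : ℕ → ℤ)).det →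
    ∀ (d : Fin n →₀ ℕ) (g : MvPolynomial (Fin n) k), (Ideal.span {g}).IsPrime → ∀ (h : MvPolynomial (Fin n) k),
    MvPolynomial.aeval (fun j : Fin n => ∏ i : Fin n, (MvPolynomial.X i : MvPolynomial (Fin n) k) ^ V i j) f = MvPolynomial.monomial d 1 * g → g ≠ 0 →
    (∀ S : Finset (Fin n), (∀ j ∈ J, 0 < ∑ i ∈ S, V i j) →
      (∀ D : ℕ, (MvPolynomial.weightedHomogeneousComponent (fun j : Fin n => ∑ i ∈ S, V i j) D f ≠ 0 ∧
          ∀ D' < D, MvPolynomial.weightedHomogeneousComponent (fun j : Fin n => ∑ i ∈ S, V i j) D' f = 0) →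
        ∀ (K : Type) [Field K] [CharP K p] [Algebra k K] (a : Fin n → K), (∀ i, i ∈ S ↔ a i = 0) →
          MvPolynomial.aeval a (MvPolynomial.aeval (fun j : Fin n => ∏ i : Fin n, (MvPolynomial.X i : MvPolynomial (Fin n) k) ^ V i j) h) ≠ 0 →
          MvPolynomial.aeval (fun j : Fin n => ∏ i : Fin n, (if i ∈ S then (1 : K) else a i) ^ V i j)
            (MvPolynomial.weightedHomogeneousComponent (fun j : Fin n => ∑ i ∈ S, V i j) D f) = 0 →
          (MvPolynomial.map (algebraMap k K) (MvPolynomial.weightedHomogeneousComponent (fun j : Fin n => ∑ i ∈ S, V i j) D f)) ^ (p - 1) ∉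
            Ideal.span (Set.range fun i : Fin n => (MvPolynomial.X i - MvPolynomial.C (∏ i' : Fin n, (if i' ∈ S then (1 : K) else a i') ^ V i' i)) ^ p))) →
    (∃ m ∈ f.support, ∀ i : Fin n, ∑ j : Fin n, V i j * m j = d i) →
    ∀ (Q : Ideal (MvPolynomial (Fin n) k ⧸ Ideal.span {g})) [Q.IsMaximal],
    (∀ j ∈ J, Ideal.Quotient.mk (Ideal.span {g}) (∏ i : Fin n, MvPolynomial.X i ^ V i j) ∈ Q) →
    Ideal.Quotient.mk (Ideal.span {g}) (MvPolynomial.aeval (fun j : Fin n => ∏ i : Fin n, (MvPolynomial.X i : MvPolynomial (Fin n) k) ^ V i j) h) ∉ Q →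
    ∀ d : ℕ, ringKrullDim (Localization.AtPrime Q) = d → ∀ s : Fin d → Localization.AtPrime Q,
        (Ideal.span (Set.range s)).radical.IsMaximal →
          RingTheory.Sequence.IsWeaklyRegular (Localization.AtPrime Q) (List.ofFn s) ∧
          ∀ y : Localization.AtPrime Q, (∃ e : ℕ, y ^ p ^ e ∈ Ideal.span
            ((fun z : Localization.AtPrime Q => z ^ p ^ e) ''
              (Ideal.span (Set.range s) : Set (Localization.AtPrime Q)))) → y ∈ Ideal.span (Set.range s) := by
  intro p _ k _ _ n J hJ f V hV dv g hgp h hθ hg0 hCN hface Q _ hXQ hhQ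
  classical
  -- the contraction `P` of `Q` to `k[y]`, its residue field `K` and the tautological point `a`
  set P : Ideal (MvPolynomial (Fin n) k) := Q.comap (Ideal.Quotient.mk (Ideal.span {g})) with hP_def
  haveI hPmax : P.IsMaximal := Ideal.comap_isMaximal_of_surjective _ Ideal.Quotient.mk_surjective
  letI : Field (MvPolynomial (Fin n) k ⧸ P) := Ideal.Quotient.field P
  haveI : CharP (MvPolynomial (Fin n) k ⧸ P) p :=
    charP_of_injective_algebraMap (algebraMap k (MvPolynomial (Fin n) k ⧸ P)).injective p
  have hgP : g ∈ P := by
    rw [hP_def, Ideal.mem_comap, Ideal.Quotient.eq_zero_iff_mem.mpr (Ideal.mem_span_singleton_self g)]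
    exact Q.zero_mem
  -- `aeval a = mk_P` on `k[y]`
  have haev : ∀ q : MvPolynomial (Fin n) k,
      MvPolynomial.aeval (fun i : Fin n => Ideal.Quotient.mk P (MvPolynomial.X i)) q = Ideal.Quotient.mk P q := by
    intro q
    have h : (MvPolynomial.aeval (R := k) (fun i : Fin n => Ideal.Quotient.mk P (MvPolynomial.X i))) =
        Ideal.Quotient.mkₐ k P := MvPolynomial.algHom_ext fun i => by
      rw [MvPolynomial.aeval_X, Ideal.Quotient.mkₐ_eq_mk]
    rw [h, Ideal.Quotient.mkₐ_eq_mk]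
  have ha : MvPolynomial.aeval (fun i : Fin n => Ideal.Quotient.mk P (MvPolynomial.X i)) g = 0 := by
    rw [haev, Ideal.Quotient.eq_zero_iff_mem]
    exact hgP
  -- the vanishing set `S` of the coordinates: every column `j ∈ J` of `V` meets it, and it is non-empty (`J ≠ ∅`)
  set S : Finset (Fin n) := Finset.univ.filter fun i => Ideal.Quotient.mk P (MvPolynomial.X i) = 0 with hS_def
  have hS : ∀ i, i ∈ S ↔ Ideal.Quotient.mk P (MvPolynomial.X i) = 0 := fun i => by
    rw [hS_def, Finset.mem_filter]
    exact ⟨fun h => h.2, fun h => ⟨Finset.mem_univ i, h⟩⟩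
  have hcol : ∀ j ∈ J, ∃ i ∈ S, 0 < V i j := by
    intro j hj
    have h1 : Ideal.Quotient.mk P (∏ i : Fin n, MvPolynomial.X i ^ V i j) = 0 := by
      rw [Ideal.Quotient.eq_zero_iff_mem, hP_def, Ideal.mem_comap]
      exact hXQ j hj
    rw [map_prod, Finset.prod_eq_zero_iff] at h1
    obtain ⟨i, -, hi⟩ := h1
    rw [map_pow] at hi
    have hV0 : V i j ≠ 0 := by
      intro h0
      rw [h0, pow_zero] at hi
      exact one_ne_zero hi
    exact ⟨i, (hS i).mpr (pow_eq_zero_iff hV0 |>.mp hi), Nat.pos_of_ne_zero hV0⟩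
  have hSpos : ∀ j ∈ J, 0 < ∑ i ∈ S, V i j := by
    intro j hj
    obtain ⟨i, hi, hVij⟩ := hcol j hj
    exact lt_of_lt_of_le hVij (Finset.single_le_sum (fun i _ => Nat.zero_le (V i j)) hi)
  have hSne : S.Nonempty := by
    obtain ⟨j₀, hj₀⟩ := hJ
    obtain ⟨i, hi, -⟩ := hcol j₀ hj₀
    exact ⟨i, hi⟩
  -- C2: Fedder's test for `g ⊗ K` at `a`
  -- the chart point lies over `D(h)`: `(θ h)(a) ≠ 0`
  have hha : MvPolynomial.aeval (fun i : Fin n => Ideal.Quotient.mk P (MvPolynomial.X i))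
      (MvPolynomial.aeval (fun j : Fin n => ∏ i : Fin n, (MvPolynomial.X i : MvPolynomial (Fin n) k) ^ V i j) h) ≠ 0 := by
    rw [haev, Ne, Ideal.Quotient.eq_zero_iff_mem, hP_def, Ideal.mem_comap]
    exact hhQ
  have hfedK := toricChart_fedder_at p f V hV dv g hθ (MvPolynomial (Fin n) k ⧸ P)
    (fun i : Fin n => Ideal.Quotient.mk P (MvPolynomial.X i)) S hS hSne
    (fun D hD hvan => hCN S hSpos D hD (MvPolynomial (Fin n) k ⧸ P) (fun i : Fin n => Ideal.Quotient.mk P (MvPolynomial.X i)) hS hha hvan)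
    (by obtain ⟨m, hm, hmin⟩ := hface; exact ⟨m, hm, fun i _ => hmin i⟩) ha
  -- C3a: `g^(p-1) ∉ P^[p]`
  have hfrob := FrobeniusPowerOfFedderAt.frobeniusPower_of_fedderAt p k n g P hfedK
  -- generators of `P` and Fedder at the maximal ideal
  obtain ⟨m, gens, hgens⟩ := Submodule.fg_iff_exists_fin_generating_family.mp ((isNoetherianRing_iff_ideal_fg _).mp inferInstance P)
  have hfed : g ^ (p - 1) ∉ Ideal.span (Set.range fun i : Fin m => gens i ^ p) := by
    intro h
    apply hfrob
    refine (Ideal.span_le.mpr ?_) h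
    rintro _ ⟨i, rfl⟩
    exact pow_mem_frobeniusPower (by rw [← hgens]; exact Submodule.subset_span ⟨i, rfl⟩)
  exact FedderAtMaximalIdeal.stub_fedderAtMaximalIdeal p k n m gens g Q hgens.symm hg0 hfed

end Summit.ResolutionOfSingularities.ResolutionOfSingularities.Theorems.FInjectiveMacaulayfication.CNChartClauseRelOpen

end
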